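import Literature.Topology.FourManifolds.SPC4HandlesSymmHolds
import Literature.Topology.FourManifolds.SPC4HandlesLemma2Direct
import Literature.Topology.FourManifolds.OneHandlebodyFundamentalGroup
import HarnessLib

/-!
# Laudenbach–Poénaru's Lemma 2: the model fact LEMMA2ᴹ and the realisation fact REALISE are
# corollaries of h₁ (and of each other)

Topic `Literature/Topology/FourManifolds`; review unit
`rsplit-Literature.Topology.FourManifo-c53aeb2579` (D-0026 review of the decomposition child
**LEMMA2ᴹ** `Literature.Topology.FourManifolds.exists_oneHandlebody_laudenbachPoenaru_exists_diffeoExtends_mapOfEq_eq`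
of `SPC4HandlesModelReduction.lean`).  Everything here is **proved**; no definition and no named
fact is introduced.

Laudenbach–Poénaru, Bull. SMF 100 (1972), §2, Lemma 2 (p. 339): for `Y_p = ♮p S¹ × D³` with a
base point `x₀ ∈ ∂Y_p`, *"`A` and `B` are surjective"*, `B : Diff Y_p → Aut π₁(∂Y_p, x₀)`.  The
tree carries three renderings of this one statement as named facts:

* **h₁** `laudenbachPoenaru_exists_diffeoExtends_mapOfEq_eq` (`SPC4HandlesProofs.lean`): on
  *every* compact connected orientable `4`-dimensional `1`-handlebody `V`, every boundary datum
  and base point, every automorphism of `π₁` of the boundary is induced by an extendable based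
  self-diffeomorphism of the boundary;
* **LEMMA2ᴹ** (`SPC4HandlesModelReduction.lean`): the same on *some* model with one `0`-handle
  and `p` `1`-handles, for every `p` (the paper's `Y_p`);
* **REALISE** `exists_oneHandlebody_realise_laudenbachPoenaruGenerators`
  (`SPC4HandlesNielsenReduction.lean`): on some such model, in some basis
  `e : π₁(∂, z₀) ≅ F_p`, each printed generator `Φ₁, Φ₂, Φ₃` (p. 339 (i)–(iii)) is so induced.

Already proved in the tree: REALISE → LEMMA2ᴹ (Nielsen's theorem, discharged;
`exists_oneHandlebody_laudenbachPoenaru_exists_diffeoExtends_mapOfEq_eq_of_nielsen`) and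
LEMMA2ᴹ → h₁ granted NORM (discharged) and the classification UNIQ₄
(`laudenbachPoenaru_exists_diffeoExtends_mapOfEq_eq_of_model`).  This file proves the remaining
arrows, which need **no** classification:

* `exists_oneHandlebody_laudenbachPoenaru_exists_diffeoExtends_mapOfEq_eq_of_forall` :
  **h₁ → LEMMA2ᴹ** — apply h₁ to the concrete model `{q(x, y) + z² + w² ≤ c} ⊂ ℝ⁴` with one
  `0`-handle and `p` `1`-handles that the tree already has in every universe (the model of the
  discharged SYMMᴹ, `exists_oneHandlebody_diffeoExtends_isOrientationReversing_holds`,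
  `SPC4HandlesSymmHolds.lean`);
* `exists_oneHandlebody_realise_laudenbachPoenaruGenerators_of_lemma2` : **LEMMA2ᴹ → REALISE**
  — on the model of LEMMA2ᴹ *every* automorphism is realised, in particular `e⁻¹ ν e` for any
  basis `e`; a basis exists because `π₁(∂V₀, z₀) ≅ π₁(V₀, z₀)` (`i_#` bijective, p. 339:
  `HasHandleDecomposition.inclFundamentalGroupEquiv`, `SPC4HandlesLemma2Direct.lean`) and
  `π₁(V₀) ≅ F_p` for a `1`-handlebody with one `0`-handle and `p` `1`-handles
  (`HasHandleDecomposition.isFreeOfRank_fundamentalGroup`, `OneHandlebodyFundamentalGroup.lean`;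
  Milnor 1963, Thm. 3.5);
* `exists_oneHandlebody_realise_laudenbachPoenaruGenerators_of_forall` : **h₁ → REALISE**.

Consequently LEMMA2ᴹ ⟺ REALISE in the tree, both follow from h₁, and the three facts are **one**
proof debt: the based diffeomorphisms `H₂` (flip of a `1`-handle) and `H₃` (slide of a
`1`-handle over another) of the proof of Lemma 2 (pp. 339–340) with their action on `π₁`, which
the seat of h₁ constructs model-free (`SlideContext.lean`, `OneHandleStepContext.lean`,
`InnerAutomorphismRealisation.lean`, feeding
`laudenbachPoenaru_exists_diffeoExtends_mapOfEq_eq_of_forall_realise_nielsen` of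
`SPC4HandlesLemma2Direct.lean`).  Discharge schema, once `…_holds` of h₁ has landed:
`theorem exists_oneHandlebody_laudenbachPoenaru_exists_diffeoExtends_mapOfEq_eq_holds :=
exists_oneHandlebody_laudenbachPoenaru_exists_diffeoExtends_mapOfEq_eq_of_forall ‹h₁_holds›`
and likewise for REALISE; once `…_holds` of REALISE has landed instead, LEMMA2ᴹ is
`…_of_nielsen autFreeGroup_eq_closure_nielsen_holds ‹REALISE_holds›`.

## References

* F. Laudenbach, V. Poénaru, *A note on 4-dimensional handlebodies*, Bull. Soc. Math. France
  100 (1972), 337–344: §2, p. 339 (`i_# : π₁ ∂Y_p → π₁ Y_p` bijective; Lemma 2 "`A` and `B`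
  are surjective"; `Φ₁, Φ₂, Φ₃`), p. 340 (the slide `H₃`).  Held: `lit read
  doi-10-24033-bsmf-1741`, PDF pp. 4–5. [LaudenbachPoenaruBSMF1972]
* J. Milnor, *Morse theory*, Ann. of Math. Studies 51 (1963), Thm. 3.5. [Milnor1963]
* Y. Matsumoto, *An introduction to Morse theory* (2001), §5.3. [Matsumoto2001]
-/

open scoped Manifold ContDiff Topology
open Set Function

noncomputable section

namespace Literature.Topology.FourManifolds

universe u

/-- **h₁ → LEMMA2ᴹ.**  Laudenbach–Poénaru's Lemma 2 on every compact connected orientable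
`4`-dimensional `1`-handlebody (`laudenbachPoenaru_exists_diffeoExtends_mapOfEq_eq`) gives it on
the model: for every `p` the tree has a compact connected orientable smooth `4`-manifold with
boundary with one `0`-handle and `p` `1`-handles together with a boundary datum (the model
`{q(x, y) + z² + w² ≤ c}` of `exists_oneHandlebody_diffeoExtends_isOrientationReversing_holds`),
which is a `1`-handlebody with handles of index `≤ 1`
(`isHandlebodyOfIndexLE_one_of_hasHandleDecomposition_handleCount_one`); apply h₁ to it at any
base point. [cite: LaudenbachPoenaruBSMF1972, §2, Lemma 2 (p. 339)] -/
theorem exists_oneHandlebody_laudenbachPoenaru_exists_diffeoExtends_mapOfEq_eq_of_forall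
    (h₁ : laudenbachPoenaru_exists_diffeoExtends_mapOfEq_eq.{u}) :
    exists_oneHandlebody_laudenbachPoenaru_exists_diffeoExtends_mapOfEq_eq.{u} := by
  intro p
  obtain ⟨V₀, _, _, _, _, _, _, _, b₀, ρ₀, hk₀, ho₀, -, -, z₀, -, -⟩ :=
    exists_oneHandlebody_diffeoExtends_isOrientationReversing_holds.{u} p
  exact ⟨V₀, inferInstance, inferInstance, inferInstance, inferInstance, inferInstance,
    inferInstance, inferInstance, b₀, z₀, hk₀, ho₀, fun θ =>
      h₁ V₀ (isHandlebodyOfIndexLE_one_of_hasHandleDecomposition_handleCount_one hk₀) ho₀ b₀ z₀ θ⟩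

/-- **A basis of `π₁` of the boundary of a `4`-dimensional `1`-handlebody with one `0`-handle and
`p` `1`-handles**: `π₁(b.carrier, z) ≅ F_p`, as `π₁(b.carrier, z) ≅ π₁(V, b.incl z)`
(Laudenbach–Poénaru p. 339, "`i_#` is bijective": `HasHandleDecomposition.inclFundamentalGroupEquiv`)
followed by `π₁(V, b.incl z) ≅ F_p` (the fundamental group of a `1`-handlebody is free on the
`1`-handles, Milnor 1963, Thm. 3.5: `HasHandleDecomposition.isFreeOfRank_fundamentalGroup`).
[cite: LaudenbachPoenaruBSMF1972, §2, p. 339] [cite: Milnor1963, Thm. 3.5] -/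
theorem HasHandleDecomposition.nonempty_fundamentalGroup_boundary_mulEquiv_freeGroup
    {V : Type u} [TopologicalSpace V] [T2Space V] [SecondCountableTopology V] [CompactSpace V]
    [ConnectedSpace V] [ChartedSpace (EuclideanHalfSpace 4) V] [IsManifold (𝓡∂ 4) ∞ V]
    {p : ℕ} (hk : HasHandleDecomposition 3 V (handleCount 1 p))
    (b : BoundaryData (𝓡∂ 4) V (𝓡 3)) (z : b.carrier) :
    Nonempty (FundamentalGroup b.carrier z ≃* FreeGroup (Fin p)) := by
  obtain ⟨f⟩ := hk.isFreeOfRank_fundamentalGroup (handleCount_zero 1 p) (handleCount_one 1 p)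
    (fun k hk2 => handleCount_of_two_le 1 p hk2) (b.incl z)
  exact ⟨(hk.inclFundamentalGroupEquiv b z).trans f.symm⟩

/-- **LEMMA2ᴹ → REALISE.**  On the model `(V₀, b₀, z₀)` of LEMMA2ᴹ every automorphism of
`π₁(b₀.carrier, z₀)` is induced by an extendable based self-diffeomorphism of the boundary; in
particular, for any basis `e : π₁(b₀.carrier, z₀) ≅ F_p`
(`HasHandleDecomposition.nonempty_fundamentalGroup_boundary_mulEquiv_freeGroup`) and any
automorphism `ν` of `F_p` — a fortiori for Laudenbach–Poénaru's `Φ₁, Φ₂, Φ₃`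
(`laudenbachPoenaruGenerators p`) — the automorphism `e⁻¹ ν e` is so induced, which is REALISE
(`exists_oneHandlebody_realise_laudenbachPoenaruGenerators`).  With
`exists_oneHandlebody_laudenbachPoenaru_exists_diffeoExtends_mapOfEq_eq_of_nielsen` (REALISE →
LEMMA2ᴹ) the two named facts are equivalent in the tree.
[cite: LaudenbachPoenaruBSMF1972, §2, Lemma 2 and its proof (pp. 339–340)] -/
theorem exists_oneHandlebody_realise_laudenbachPoenaruGenerators_of_lemma2
    (hL : exists_oneHandlebody_laudenbachPoenaru_exists_diffeoExtends_mapOfEq_eq.{u}) :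
    exists_oneHandlebody_realise_laudenbachPoenaruGenerators.{u} := by
  intro p
  obtain ⟨V₀, _, _, _, _, _, _, _, b₀, z₀, hk₀, ho₀, hL₀⟩ := hL p
  obtain ⟨e⟩ := hk₀.nonempty_fundamentalGroup_boundary_mulEquiv_freeGroup b₀ z₀
  refine ⟨V₀, inferInstance, inferInstance, inferInstance, inferInstance, inferInstance,
    inferInstance, inferInstance, b₀, z₀, e, hk₀, ho₀, fun ν _ => ?_⟩
  obtain ⟨χ, hχ, hz, hmap⟩ := hL₀ (e.trans ((ν : FreeGroup (Fin p) ≃* FreeGroup (Fin p)).trans e.symm))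
  exact ⟨χ, hχ, hz, fun a => by rw [hmap]; rfl⟩

/-- **h₁ → REALISE**: the realisation of `Φ₁, Φ₂, Φ₃` on one model per `p`
(`exists_oneHandlebody_realise_laudenbachPoenaruGenerators`) follows from Laudenbach–Poénaru's
Lemma 2 on every `1`-handlebody (`laudenbachPoenaru_exists_diffeoExtends_mapOfEq_eq`), through
LEMMA2ᴹ. [cite: LaudenbachPoenaruBSMF1972, §2, Lemma 2 and its proof (pp. 339–340)] -/
theorem exists_oneHandlebody_realise_laudenbachPoenaruGenerators_of_forall
    (h₁ : laudenbachPoenaru_exists_diffeoExtends_mapOfEq_eq.{u}) :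
    exists_oneHandlebody_realise_laudenbachPoenaruGenerators.{u} :=
  exists_oneHandlebody_realise_laudenbachPoenaruGenerators_of_lemma2
    (exists_oneHandlebody_laudenbachPoenaru_exists_diffeoExtends_mapOfEq_eq_of_forall h₁)

end Literature.Topology.FourManifolds

end
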